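import Summits.CriticalPhenomena.PercolationContinuityZ3.Theorems.PercNearOneGluingNoHeavyLowerTailThreePartitionOneOrTwisted
import Summits.CriticalPhenomena.PercolationContinuityZ3.Theorems.PercNearOneGluingNoHeavyLowerTailThreePartitionGridOrOrTwistedPositivity
import HarnessLib.Audit

/-!
# `NoHeavyLowerTail` (crux stmt-CriticalPhenomena-4575), master-family hierarchy P3 (gen 37): COMB-C3 for ONE disjunction —
# Sahi's `E₃(μ_p; 1_U, 1_V, 1_{OR Q}) ` is comb-positive for ALL increasing `U, V`

Support file (seat `prim-masterthm-p3`; `--supports stmt-CriticalPhenomena-4575`).  Corollaries of the one-disjunction theorem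
`threePartNT_orFam_nonneg` (`…ThreePartitionOneOrTwisted`) through the comb bridge (`combCoef3_eq_threePartNT`,
`combPos_sahiE_three_of_combCoef3_nonneg` of `…CombBridge`; the sections of a disjunction are `⊤` or a disjunction, `secFam_orFam` of
`…GridOrOrTwistedPositivity`).  This supersedes the two-disjunction results `combPos_sahiE_three_orOr` / `sahiE_three_orOr_nonneg`
(there `V` had to be a disjunction too).
HONEST LABEL: COMB-C3 for the class (increasing, increasing, disjunction) on every product cube; the general COMB-C3 (three arbitrary
increasing events) stays OPEN; nothing bears on the (closed) crux. [this work]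
-/

noncomputable section

open scoped Classical symmDiff
open Finset

namespace Summit.CriticalPhenomena.PercolationContinuityZ3.Theorems.ThreePartition

section Comb

open Literature.Combinatorics.Sahi2008
open SahiComb

variable {α : Type} [Fintype α]

/-- **COMB-C3 for one disjunction**: for all increasing events `U, V` and every `Q`, Sahi's `E₃(μ_p; 1_U, 1_V, 1_{OR Q})` is a nonnegative
combination of the degree-3 tensor-Bernstein basis on the product cube (coefficient at a profile = the twisted three-partition functional
of the sections, `combCoef3_eq_threePartNT`; the section of a disjunction is `⊤` or a disjunction, `secFam_orFam`; then
`threePartNT_nonneg_of_univ_or_or₃`). [this work] -/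
theorem combPos_sahiE_three_or {U V : Set (Set α)} (hU : IsUpperSet U) (hV : IsUpperSet V) (Q : Set α) :
    CombPos (fun _ : α => 3) (fun p => sahiE (bernoulliWeight p) 3 ![Literature.Probability.Percolation.DecisionTree.ind U,
      Literature.Probability.Percolation.DecisionTree.ind V, Literature.Probability.Percolation.DecisionTree.ind (orFam Q)]) := by
  refine combPos_sahiE_three_of_combCoef3_nonneg fun j => ?_
  by_cases hj : ∀ e, j e ≤ 3
  · rw [combCoef3_eq_threePartNT U V (orFam Q) hj]
    have h𝒲 : secFam j (orFam Q) = Set.univ ∨ ∃ Q' : Set (Act j), secFam j (orFam Q) = orFam Q' :=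
      (secFam_orFam j Q).imp id fun h => ⟨_, h⟩
    exact_mod_cast threePartNT_nonneg_of_univ_or_or₃ (twist j) (isUpperSet_secFam j hU) (isUpperSet_secFam j hV) h𝒲
  · rw [combCoef3_eq_zero_of_not_le U V (orFam Q) hj]

/-- **Sahi's `E₃ ≥ 0` for (increasing, increasing, disjunction) under every product measure.** [this work] -/
theorem sahiE_three_or_nonneg {U V : Set (Set α)} (hU : IsUpperSet U) (hV : IsUpperSet V) (Q : Set α) (p : α → unitInterval) :
    0 ≤ sahiE (bernoulliWeight p) 3 ![Literature.Probability.Percolation.DecisionTree.ind U,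
      Literature.Probability.Percolation.DecisionTree.ind V, Literature.Probability.Percolation.DecisionTree.ind (orFam Q)] :=
  (combPos_sahiE_three_or hU hV Q).nonneg p

end Comb

end Summit.CriticalPhenomena.PercolationContinuityZ3.Theorems.ThreePartition

end
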